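import Mathlib
import HarnessLib

/-!
# Line-bound bricks: an effective two-sided Stirling bound for `log n!`

HONEST FRAMING: systematic search; no irrationality claim unless certified.

Cell pub-zeta5, T3 service (P1 g9) for the factorial normalisation `(11n)!/((13n)!(9n)!(5n)!)` in E5
(`families/denom/P15KERNEL.md` §6.1): Mathlib's `Stirling.le_log_factorial_stirling` is the effective LOWER bound
`n log n − n + ½log n + ½log(2π) ≤ log n!`; this file adds the effective UPPER bound
**`log_factorial_le_stirling : log n! ≤ n log n − n + ½log n + 1`** (`n ≥ 1`; from the antitonicity of the Stirling
sequence, `stirlingSeq n ≤ stirlingSeq 1 = e/√2`), so that every `log (cn)!` is `cn·log(cn) − cn + O(log n)` with explicit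
constants on both sides (`log_factorial_two_sided`).
-/

noncomputable section

open Real

namespace Summit.KontsevichZagierPeriods.Zeta5Search.TwoTaleLineBound

/-- **Effective Stirling upper bound**: `log n! ≤ n log n − n + ½ log n + 1` for `n ≥ 1`. -/
theorem log_factorial_le_stirling {n : ℕ} (hn : n ≠ 0) :
    Real.log (Nat.factorial n) ≤ n * Real.log n - n + Real.log n / 2 + 1 := by
  obtain ⟨m, rfl⟩ := Nat.exists_eq_succ_of_ne_zero hn
  have hanti := Stirling.stirlingSeq'_antitone (Nat.zero_le m)
  simp only [Function.comp_apply, Nat.succ_eq_add_one, zero_add, Stirling.stirlingSeq_one] at hanti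
  -- stirlingSeq (m+1) = (m+1)! / (√(2(m+1)) ((m+1)/e)^(m+1)) ≤ e/√2
  set N : ℕ := m + 1 with hN
  have hNpos : (0 : ℝ) < N := by positivity
  have hD : 0 < Real.sqrt (2 * (N : ℝ)) * ((N : ℝ) / rexp 1) ^ N := by positivity
  have hfac : (Nat.factorial N : ℝ) ≤ rexp 1 / Real.sqrt 2 * (Real.sqrt (2 * (N : ℝ)) * ((N : ℝ) / rexp 1) ^ N) := by
    have h := hanti
    unfold Stirling.stirlingSeq at h
    rwa [div_le_iff₀ hD] at h
  have hrhs : rexp 1 / Real.sqrt 2 * (Real.sqrt (2 * (N : ℝ)) * ((N : ℝ) / rexp 1) ^ N) =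
      rexp 1 * Real.sqrt N * ((N : ℝ) / rexp 1) ^ N := by
    rw [Real.sqrt_mul' _ hNpos.le]
    have h2 : Real.sqrt 2 ≠ 0 := by positivity
    field_simp
  rw [hrhs] at hfac
  have hpos : (0 : ℝ) < Nat.factorial N := by exact_mod_cast Nat.factorial_pos N
  calc Real.log (Nat.factorial N) ≤ Real.log (rexp 1 * Real.sqrt N * ((N : ℝ) / rexp 1) ^ N) :=
        Real.log_le_log hpos hfac
    _ = N * Real.log N - N + Real.log N / 2 + 1 := by
        rw [Real.log_mul (by positivity) (by positivity), Real.log_mul (by positivity) (by positivity), Real.log_exp,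
          Real.log_sqrt hNpos.le, Real.log_pow, Real.log_div hNpos.ne' (Real.exp_pos 1).ne', Real.log_exp]
        ring

/-- **Two-sided effective Stirling**: `|log n! − (n log n − n + ½ log n)| ≤ 1` in the form of the two inequalities
(lower constant `½log(2π) ≥ 0`, upper constant `1`), `n ≥ 1`. -/
theorem log_factorial_two_sided {n : ℕ} (hn : n ≠ 0) :
    n * Real.log n - n + Real.log n / 2 ≤ Real.log (Nat.factorial n) ∧
      Real.log (Nat.factorial n) ≤ n * Real.log n - n + Real.log n / 2 + 1 := by
  refine ⟨?_, log_factorial_le_stirling hn⟩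
  have h := Stirling.le_log_factorial_stirling hn
  have h2π : 0 ≤ Real.log (2 * π) / 2 := by
    have : (1 : ℝ) ≤ 2 * π := by linarith [Real.pi_gt_three]
    have := Real.log_nonneg this
    linarith
  linarith

end Summit.KontsevichZagierPeriods.Zeta5Search.TwoTaleLineBound

end
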